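import Mathlib
import Literature.Probability.LatticeModels.ThermodynamicLimit

/-!
# Lattice Riemann sums for stub `stub_treeDecayBoundsGerm` of line `lee-yang-mass-handover`
(crux `Summit.QuantumFields.QCD.Theses.HeatSlicedQuarks.RobustYangMillsHandover`,
item stmt-QuantumFields-8892; serves item stmt-QuantumFields-16261
`AnomalyRigidity.TreeDecayBoundsGerm`)

Uniform bounds for lattice sums with an integrable power singularity, at lattice resolution:
* `treeGerm_sum_range_rpow_le`: the telescoping (Bernoulli) bound `∑_{n<N} (n+1)^{θ−1} ≤ N^θ/θ`,
  `0 < θ ≤ 1`;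
* `treeGerm_one_dim_int_bound`: `a ∑_{|n| ≤ T} (a + a|n|)^{−s} e^{−c a|n|} ≤ 2(1/(1−s) + (1+c)/c)`
  for `0 ≤ s < 1`, `0 < c`, `0 < a ≤ 1` (geometric series plus the singular piece);
* `treeGerm_four_dim_bound`: `a⁴ ∑_{z ∈ box 4 T} (a + ‖a z‖)^{−s} e^{−c‖a z‖} ≤ Λ(s,c)` uniformly in
  `0 < a ≤ 1` and `T`, for `0 ≤ s < 4` (sup norm on `Fin 4 → ℝ`; factorisation over the four
  coordinates via `Finset.sum_pow'`);
* `treeGerm_pointwise_far_bound`: the pointwise inequality absorbing polynomial weights, a possibly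
  negative decay exponent `σ` and the partial-diagonal singularity `(a + min(X, Y, D))^{−σ}` into
  separately summable one-particle factors.

Pure Mathlib real analysis (plus `Literature.Probability.LatticeModels.box`).
-/

namespace Summit.QuantumFields.QCD.Cruxes.RobustYangMillsHandover.LeeYangMassHandover

open Filter Topology Asymptotics Finset Literature.Probability.LatticeModels

/-- Telescoping bound `∑_{n<N} (n+1)^{θ-1} ≤ N^θ / θ` for `0 < θ ≤ 1` (Bernoulli). [folklore] -/
theorem treeGerm_sum_range_rpow_le (θ : ℝ) (hθ : 0 < θ) (hθ1 : θ ≤ 1) (N : ℕ) :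
    ∑ n ∈ Finset.range N, ((n : ℝ) + 1) ^ (θ - 1) ≤ (N : ℝ) ^ θ / θ := by
  induction N with
  | zero => simp; positivity
  | succ N ih =>
    rw [Finset.sum_range_succ, le_div_iff₀ hθ]
    have ih' : (∑ n ∈ Finset.range N, ((n : ℝ) + 1) ^ (θ - 1)) * θ ≤ (N : ℝ) ^ θ :=
      (le_div_iff₀ hθ).mp ih
    -- Bernoulli: N^θ ≤ (N+1)^θ - θ (N+1)^(θ-1)
    have hM : (0 : ℝ) < (N : ℝ) + 1 := by positivity
    have hB : (N : ℝ) ^ θ ≤ ((N : ℝ) + 1) ^ θ - θ * ((N : ℝ) + 1) ^ (θ - 1) := by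
      have h1 : (N : ℝ) = ((N : ℝ) + 1) * (1 + -((N : ℝ) + 1)⁻¹) := by field_simp; ring
      have h2 : (1 + -((N : ℝ) + 1)⁻¹) ^ θ ≤ 1 + θ * -((N : ℝ) + 1)⁻¹ := by
        refine rpow_one_add_le_one_add_mul_self ?_ hθ.le hθ1
        rw [neg_le_neg_iff]
        exact inv_le_one_of_one_le₀ (by linarith)
      have h3 : 0 ≤ 1 + -((N : ℝ) + 1)⁻¹ := by
        have : ((N : ℝ) + 1)⁻¹ ≤ 1 := inv_le_one_of_one_le₀ (by linarith)
        linarith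
      calc (N : ℝ) ^ θ = (((N : ℝ) + 1) * (1 + -((N : ℝ) + 1)⁻¹)) ^ θ := by rw [← h1]
        _ = ((N : ℝ) + 1) ^ θ * (1 + -((N : ℝ) + 1)⁻¹) ^ θ := Real.mul_rpow hM.le h3
        _ ≤ ((N : ℝ) + 1) ^ θ * (1 + θ * -((N : ℝ) + 1)⁻¹) :=
            mul_le_mul_of_nonneg_left h2 (Real.rpow_nonneg hM.le _)
        _ = ((N : ℝ) + 1) ^ θ - θ * ((N : ℝ) + 1) ^ (θ - 1) := by
            rw [Real.rpow_sub_one hM.ne']; ring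
    push_cast
    nlinarith

/-- Reduction of a sum over the symmetric integer interval to two sums over naturals. [folklore] -/
theorem treeGerm_sum_Icc_le_two_range (T : ℕ) (F : ℤ → ℝ) (hF : ∀ n, 0 ≤ F n) :
    ∑ n ∈ Finset.Icc (-(T : ℤ)) T, F n
      ≤ ∑ n ∈ Finset.range (T + 1), F n + ∑ n ∈ Finset.range (T + 1), F (-(n : ℤ)) := by
  classical
  have hsub : Finset.Icc (-(T : ℤ)) T ⊆
      (Finset.range (T + 1)).image (fun n : ℕ => (n : ℤ)) ∪
        (Finset.range (T + 1)).image (fun n : ℕ => -(n : ℤ)) := by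
    intro n hn
    rw [Finset.mem_Icc] at hn
    rw [Finset.mem_union, Finset.mem_image, Finset.mem_image]
    rcases le_or_gt 0 n with h | h
    · exact Or.inl ⟨n.toNat, by rw [Finset.mem_range]; omega, by omega⟩
    · exact Or.inr ⟨(-n).toNat, by rw [Finset.mem_range]; omega, by omega⟩
  calc ∑ n ∈ Finset.Icc (-(T : ℤ)) T, F n
      ≤ ∑ n ∈ (Finset.range (T + 1)).image (fun n : ℕ => (n : ℤ)) ∪
          (Finset.range (T + 1)).image (fun n : ℕ => -(n : ℤ)), F n :=
        Finset.sum_le_sum_of_subset_of_nonneg hsub fun _ _ _ => hF _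
    _ ≤ ∑ n ∈ (Finset.range (T + 1)).image (fun n : ℕ => (n : ℤ)), F n +
          ∑ n ∈ (Finset.range (T + 1)).image (fun n : ℕ => -(n : ℤ)), F n := by
        rw [← Finset.sum_union_inter]
        exact le_add_of_nonneg_right (Finset.sum_nonneg fun _ _ => hF _)
    _ = _ := by
        have hinj1 : Set.InjOn (fun n : ℕ => (n : ℤ)) ↑(Finset.range (T + 1)) :=
          fun x _ y _ h => by beta_reduce at h; exact_mod_cast h
        have hinj2 : Set.InjOn (fun n : ℕ => -(n : ℤ)) ↑(Finset.range (T + 1)) :=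
          fun x _ y _ h => by beta_reduce at h; exact_mod_cast neg_inj.mp h
        rw [Finset.sum_image hinj1, Finset.sum_image hinj2]

/-- Geometric piece of the one-dimensional lattice sum: `∑_{n<N} a e^{-c a n} ≤ (1 + c)/c`
for `0 < a ≤ 1`, `0 < c`. [folklore] -/
theorem treeGerm_geom_piece (c a : ℝ) (hc : 0 < c) (ha : 0 < a) (ha1 : a ≤ 1) (N : ℕ) :
    ∑ n ∈ Finset.range N, a * Real.exp (-(c * (a * n))) ≤ (1 + c) / c := by
  have hu : 0 < c * a := mul_pos hc ha
  have hr0 : 0 ≤ Real.exp (-(c * a)) := (Real.exp_pos _).le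
  have hr1 : Real.exp (-(c * a)) < 1 := Real.exp_lt_one_iff.mpr (by linarith)
  have hgeom : ∑ n ∈ Finset.range N, Real.exp (-(c * a)) ^ n ≤ 1 / (1 - Real.exp (-(c * a))) := by
    have := geom_sum_Ico_le_of_lt_one (m := 0) (n := N) hr0 hr1
    rwa [pow_zero, ← Finset.range_eq_Ico] at this
  have hterm : ∀ n : ℕ, Real.exp (-(c * (a * n))) = Real.exp (-(c * a)) ^ n := by
    intro n; rw [← Real.exp_nat_mul]; congr 1; ring
  have hexp : Real.exp (-(c * a)) ≤ 1 / (1 + c * a) := by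
    rw [Real.exp_neg, one_div]
    exact inv_anti₀ (by positivity) (by linarith [Real.add_one_le_exp (c * a)])
  have hden : c * a / (1 + c * a) ≤ 1 - Real.exp (-(c * a)) := by
    have : 1 - 1 / (1 + c * a) = c * a / (1 + c * a) := by field_simp; ring
    linarith
  have hq : 0 < c * a / (1 + c * a) := by positivity
  calc ∑ n ∈ Finset.range N, a * Real.exp (-(c * (a * n)))
      = a * ∑ n ∈ Finset.range N, Real.exp (-(c * a)) ^ n := by
        rw [Finset.mul_sum]; exact Finset.sum_congr rfl fun n _ => by rw [hterm]
    _ ≤ a * (1 / (1 - Real.exp (-(c * a)))) := mul_le_mul_of_nonneg_left hgeom ha.le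
    _ ≤ a * (1 / (c * a / (1 + c * a))) :=
        mul_le_mul_of_nonneg_left (one_div_le_one_div_of_le hq hden) ha.le
    _ = (1 + c * a) / c := by field_simp
    _ ≤ (1 + c) / c := by gcongr; nlinarith

/-- Singular piece of the one-dimensional lattice sum:
`∑_{n<N, a(n+1) ≤ 1} a (a(n+1))^{-s} ≤ 1/(1-s)` for `0 ≤ s < 1`, `0 < a`. [folklore] -/
theorem treeGerm_sing_piece (s a : ℝ) (hs : 0 ≤ s) (hs1 : s < 1) (ha : 0 < a) (N : ℕ) :
    ∑ n ∈ Finset.range N, (if a * ((n : ℝ) + 1) ≤ 1 then a * (a * ((n : ℝ) + 1)) ^ (-s) else 0)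
      ≤ 1 / (1 - s) := by
  have hθ : 0 < 1 - s := by linarith
  calc ∑ n ∈ Finset.range N, (if a * ((n : ℝ) + 1) ≤ 1 then a * (a * ((n : ℝ) + 1)) ^ (-s) else 0)
      = ∑ n ∈ (Finset.range N).filter (fun n : ℕ => a * ((n : ℝ) + 1) ≤ 1),
          a * (a * ((n : ℝ) + 1)) ^ (-s) := by
        rw [Finset.sum_filter]
    _ ≤ ∑ n ∈ Finset.range ⌊1 / a⌋₊, a * (a * ((n : ℝ) + 1)) ^ (-s) := by
        refine Finset.sum_le_sum_of_subset_of_nonneg ?_ fun n _ _ => by positivity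
        intro n hn
        rw [Finset.mem_filter] at hn
        rw [Finset.mem_range]
        have h1 : ((n : ℝ) + 1) ≤ 1 / a := by rw [le_div_iff₀ ha]; linarith [hn.2]
        have h2 : n + 1 ≤ ⌊1 / a⌋₊ := Nat.le_floor (by push_cast; exact h1)
        omega
    _ = a ^ (1 - s) * ∑ n ∈ Finset.range ⌊1 / a⌋₊, ((n : ℝ) + 1) ^ ((1 - s) - 1) := by
        rw [Finset.mul_sum]
        refine Finset.sum_congr rfl fun n _ => ?_
        rw [Real.mul_rpow ha.le (by positivity), show (1 - s) - 1 = -s by ring, ← mul_assoc]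
        congr 1
        rw [Real.rpow_sub ha, Real.rpow_one, Real.rpow_neg ha.le, div_eq_mul_inv]
    _ ≤ a ^ (1 - s) * (((⌊1 / a⌋₊ : ℕ) : ℝ) ^ (1 - s) / (1 - s)) :=
        mul_le_mul_of_nonneg_left (treeGerm_sum_range_rpow_le (1 - s) hθ (by linarith) _)
          (by positivity)
    _ = (a * ⌊1 / a⌋₊) ^ (1 - s) / (1 - s) := by
        rw [Real.mul_rpow ha.le (by positivity)]; ring
    _ ≤ 1 / (1 - s) := by
        gcongr
        refine Real.rpow_le_one (by positivity) ?_ hθ.le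
        have : ((⌊1 / a⌋₊ : ℕ) : ℝ) ≤ 1 / a := Nat.floor_le (by positivity)
        rwa [le_div_iff₀ ha, mul_comm] at this

/-- One-dimensional lattice sum over naturals:
`∑_{n<N} a (a + a n)^{-s} e^{-c a n} ≤ 1/(1-s) + (1+c)/c` for `0 ≤ s < 1`, `0 < c`, `0 < a ≤ 1`.
[folklore] -/
theorem treeGerm_one_dim_nat_bound (s c a : ℝ) (hs : 0 ≤ s) (hs1 : s < 1) (hc : 0 < c) (ha : 0 < a)
    (ha1 : a ≤ 1) (N : ℕ) :
    ∑ n ∈ Finset.range N, a * ((a + a * (n : ℝ)) ^ (-s) * Real.exp (-(c * (a * (n : ℝ)))))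
      ≤ 1 / (1 - s) + (1 + c) / c := by
  have hpt : ∀ n : ℕ, a * ((a + a * (n : ℝ)) ^ (-s) * Real.exp (-(c * (a * (n : ℝ)))))
      ≤ (if a * ((n : ℝ) + 1) ≤ 1 then a * (a * ((n : ℝ) + 1)) ^ (-s) else 0)
          + a * Real.exp (-(c * (a * n))) := by
    intro n
    have he1 : Real.exp (-(c * (a * n))) ≤ 1 := Real.exp_le_one_iff.mpr (by
      have : 0 ≤ c * (a * n) := by positivity
      linarith)
    have he0 : 0 < Real.exp (-(c * (a * n))) := Real.exp_pos _
    have hbase : a + a * (n : ℝ) = a * ((n : ℝ) + 1) := by ring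
    rw [hbase]
    have hr : 0 ≤ (a * ((n : ℝ) + 1)) ^ (-s) := by positivity
    split_ifs with h
    · nlinarith [mul_le_of_le_one_right hr he1]
    · have hr1 : (a * ((n : ℝ) + 1)) ^ (-s) ≤ 1 :=
        Real.rpow_le_one_of_one_le_of_nonpos (le_of_lt (not_le.mp h)) (by linarith)
      nlinarith [mul_le_mul hr1 le_rfl he0.le zero_le_one]
  calc ∑ n ∈ Finset.range N, a * ((a + a * (n : ℝ)) ^ (-s) * Real.exp (-(c * (a * (n : ℝ)))))
      ≤ ∑ n ∈ Finset.range N, ((if a * ((n : ℝ) + 1) ≤ 1 then a * (a * ((n : ℝ) + 1)) ^ (-s) else 0)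
          + a * Real.exp (-(c * (a * n)))) := Finset.sum_le_sum fun n _ => hpt n
    _ = _ := Finset.sum_add_distrib
    _ ≤ 1 / (1 - s) + (1 + c) / c :=
        add_le_add (treeGerm_sing_piece s a hs hs1 ha N) (treeGerm_geom_piece c a hc ha ha1 N)

/-- One-dimensional lattice sum over the symmetric integer interval. [folklore] -/
theorem treeGerm_one_dim_int_bound (s c a : ℝ) (hs : 0 ≤ s) (hs1 : s < 1) (hc : 0 < c) (ha : 0 < a)
    (ha1 : a ≤ 1) (T : ℕ) :
    a * ∑ n ∈ Finset.Icc (-(T : ℤ)) T,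
        (a + a * |(n : ℝ)|) ^ (-s) * Real.exp (-(c * (a * |(n : ℝ)|)))
      ≤ 2 * (1 / (1 - s) + (1 + c) / c) := by
  rw [Finset.mul_sum]
  have hF : ∀ n : ℤ, 0 ≤ a * ((a + a * |(n : ℝ)|) ^ (-s) * Real.exp (-(c * (a * |(n : ℝ)|)))) :=
    fun n => by positivity
  refine (treeGerm_sum_Icc_le_two_range T _ hF).trans ?_
  have h1 := treeGerm_one_dim_nat_bound s c a hs hs1 hc ha ha1 (T + 1)
  simp only [Int.cast_natCast, Int.cast_neg, abs_neg, Nat.abs_cast] at *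
  linarith

/-- Four-dimensional lattice Riemann sum with an integrable power singularity:
`a⁴ ∑_{z ∈ box} (a + ‖a z‖)^{-s} e^{-c ‖a z‖} ≤ Λ(s, c)` uniformly in `0 < a ≤ 1` and the box,
for `0 ≤ s < 4`, `0 < c` (sup norm; factorisation over coordinates). [folklore] -/
theorem treeGerm_four_dim_bound :
    ∀ s c : ℝ, 0 ≤ s → s < 4 → 0 < c → ∃ Λ : ℝ, 0 ≤ Λ ∧ ∀ a : ℝ, 0 < a → a ≤ 1 → ∀ φ : (Fin 4 → ℤ)
    → (Fin 4 → ℝ), (∀ x i, φ x i = a * (x i : ℝ)) → ∀ T : ℕ, a ^ 4 * ∑ z ∈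
    Literature.Probability.LatticeModels.box 4 T, (a + ‖φ z‖) ^ (-s) * Real.exp (-(c * ‖φ z‖)) ≤ Λ := by
  intro s c hs hs4 hc
  have hs' : 0 < 1 - s / 4 := by linarith
  refine ⟨(2 * (1 / (1 - s / 4) + (1 + c / 4) / (c / 4))) ^ 4, by positivity,
    fun a ha ha1 φ hφ T => ?_⟩
  set f : ℤ → ℝ := fun n => (a + a * |(n : ℝ)|) ^ (-(s / 4)) * Real.exp (-(c / 4 * (a * |(n : ℝ)|)))
    with hf
  have hpt : ∀ z : Fin 4 → ℤ, (a + ‖φ z‖) ^ (-s) * Real.exp (-(c * ‖φ z‖)) ≤ ∏ i, f (z i) := by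
    intro z
    have hzi : ∀ i, a * |(z i : ℝ)| ≤ ‖φ z‖ := fun i => by
      have := norm_le_pi_norm (φ z) i
      rwa [hφ z i, Real.norm_eq_abs, abs_mul, abs_of_pos ha] at this
    have hlhs : (a + ‖φ z‖) ^ (-s) * Real.exp (-(c * ‖φ z‖))
        = ∏ _i : Fin 4, ((a + ‖φ z‖) ^ (-(s / 4)) * Real.exp (-(c / 4 * ‖φ z‖))) := by
      rw [Finset.prod_const, Finset.card_univ, Fintype.card_fin, mul_pow, ← Real.rpow_natCast,
        ← Real.rpow_mul (by positivity), ← Real.exp_nat_mul]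
      congr 2
      · push_cast; ring
      · push_cast; ring
    rw [hlhs]
    refine Finset.prod_le_prod (fun i _ => by positivity) fun i _ => ?_
    refine mul_le_mul ?_ ?_ (by positivity) (by positivity)
    · exact Real.rpow_le_rpow_of_nonpos (by positivity) (by linarith [hzi i]) (by linarith)
    · exact Real.exp_le_exp.mpr (by nlinarith [hzi i])
  calc a ^ 4 * ∑ z ∈ box 4 T, (a + ‖φ z‖) ^ (-s) * Real.exp (-(c * ‖φ z‖))
      ≤ a ^ 4 * ∑ z ∈ box 4 T, ∏ i, f (z i) :=
        mul_le_mul_of_nonneg_left (Finset.sum_le_sum fun z _ => hpt z) (by positivity)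
    _ = (a * ∑ n ∈ Finset.Icc (-(T : ℤ)) T, f n) ^ 4 := by
        rw [mul_pow, Finset.sum_pow']; rfl
    _ ≤ (2 * (1 / (1 - s / 4) + (1 + c / 4) / (c / 4))) ^ 4 := by
        refine pow_le_pow_left₀ (by positivity) ?_ 4
        exact treeGerm_one_dim_int_bound (s / 4) (c / 4) a (by positivity) (by linarith)
          (by positivity) ha ha1 T

/-- Pointwise bound on the far-region weight: polynomial weights and the partial-diagonal
singularity are absorbed into separately summable one-particle factors. [folklore] -/
theorem treeGerm_pointwise_far_bound (ε' σ : ℝ) (hε' : 0 < ε') (N : ℕ) (hN : -σ ≤ N) (i j : ℕ)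
    (hi : i ≤ 2) (hj : j ≤ 2) (a X Y D : ℝ) (ha : 0 < a) (ha1 : a ≤ 1) (hX : 0 ≤ X) (hY : 0 ≤ Y)
    (hD : 0 ≤ D) (hDXY : D ≤ X + Y) :
    a ^ 8 * X ^ i * Y ^ j * (Real.exp (-(ε' * max X Y)) * (1 + (a + min X (min Y D)) ^ (-σ)))
      ≤ ((4 + N).factorial / (ε' / 2) ^ (4 + N) * Real.exp (ε' / 2)) *
        (2 * ((a ^ 4 * Real.exp (-(ε' / 8 * X))) * (a ^ 4 * Real.exp (-(ε' / 8 * Y))))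
          + (a ^ 4 * ((a + X) ^ (-(max σ 0)) * Real.exp (-(ε' / 8 * X))))
              * (a ^ 4 * Real.exp (-(ε' / 8 * Y)))
          + (a ^ 4 * Real.exp (-(ε' / 8 * X)))
              * (a ^ 4 * ((a + Y) ^ (-(max σ 0)) * Real.exp (-(ε' / 8 * Y))))
          + (a ^ 4 * Real.exp (-(ε' / 8 * X)))
              * (a ^ 4 * ((a + D) ^ (-(max σ 0)) * Real.exp (-(ε' / 8 * D))))) := by
  -- notation
  set M := max X Y with hM
  set b : ℝ := ε' / 2 with hb
  set c : ℝ := ε' / 8 with hc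
  set K : ℝ := (4 + N).factorial / b ^ (4 + N) * Real.exp b with hK
  have hb0 : 0 < b := by positivity
  have hK0 : 0 ≤ K := by positivity
  have hXM : X ≤ M := le_max_left _ _
  have hYM : Y ≤ M := le_max_right _ _
  have hM0 : 0 ≤ M := hX.trans hXM
  have h1M : 1 ≤ 1 + M := by linarith
  have hdm0 : 0 ≤ min X (min Y D) := le_min hX (le_min hY hD)
  have hdmX : min X (min Y D) ≤ X := min_le_left _ _
  have hadm : 0 < a + min X (min Y D) := by linarith
  -- Step 1: polynomial weights
  have hS1 : X ^ i * Y ^ j ≤ (1 + M) ^ 4 := by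
    have h1 : X ^ i ≤ (1 + M) ^ 2 :=
      (pow_le_pow_left₀ hX (by linarith) i).trans (pow_le_pow_right₀ h1M hi)
    have h2 : Y ^ j ≤ (1 + M) ^ 2 :=
      (pow_le_pow_left₀ hY (by linarith) j).trans (pow_le_pow_right₀ h1M hj)
    calc X ^ i * Y ^ j ≤ (1 + M) ^ 2 * (1 + M) ^ 2 :=
          mul_le_mul h1 h2 (by positivity) (by positivity)
      _ = (1 + M) ^ 4 := by ring
  -- Step 2: the singular factor, reduced to a nonnegative exponent
  have hS2 : 1 + (a + min X (min Y D)) ^ (-σ)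
      ≤ (1 + M) ^ N * (2 + (a + min X (min Y D)) ^ (-(max σ 0))) := by
    have hpowN : 1 ≤ (1 + M) ^ N := one_le_pow₀ h1M
    rcases le_or_gt 0 σ with hσ0 | hσ0
    · rw [max_eq_left hσ0]
      have hr : 0 ≤ (a + min X (min Y D)) ^ (-σ) := by positivity
      nlinarith [mul_le_mul_of_nonneg_right hpowN
        (by positivity : (0:ℝ) ≤ 2 + (a + min X (min Y D)) ^ (-σ))]
    · rw [max_eq_right hσ0.le, neg_zero, Real.rpow_zero]
      have h1 : (a + min X (min Y D)) ^ (-σ) ≤ (1 + M) ^ (-σ) :=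
        Real.rpow_le_rpow hadm.le (by linarith) (by linarith)
      have h2 : (1 + M) ^ (-σ) ≤ (1 + M) ^ N := by
        rw [← Real.rpow_natCast]
        exact Real.rpow_le_rpow_of_exponent_le h1M hN
      nlinarith
  -- Step 3: min ≤ each of the three
  have hS3 : (a + min X (min Y D)) ^ (-(max σ 0))
      ≤ (a + X) ^ (-(max σ 0)) + (a + Y) ^ (-(max σ 0)) + (a + D) ^ (-(max σ 0)) := by
    have h0X : 0 ≤ (a + X) ^ (-(max σ 0)) := by positivity
    have h0Y : 0 ≤ (a + Y) ^ (-(max σ 0)) := by positivity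
    have h0D : 0 ≤ (a + D) ^ (-(max σ 0)) := by positivity
    rcases min_choice Y D with h | h <;> rcases min_choice X (min Y D) with h' | h' <;>
      rw [h'] <;> (try rw [h]) <;> linarith
  -- Step 4: exponential beats polynomial
  have hS4 : Real.exp (-(ε' * M)) * (1 + M) ^ (4 + N) ≤ K * Real.exp (-(b * M)) := by
    have hfac := Real.pow_div_factorial_le_exp (x := b * (1 + M)) (by positivity) (4 + N)
    rw [div_le_iff₀ (by positivity), mul_pow] at hfac
    have hbn : 0 < b ^ (4 + N) := by positivity
    have h1 : (1 + M) ^ (4 + N) ≤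
        (4 + N).factorial / b ^ (4 + N) * Real.exp b * Real.exp (b * M) := by
      have := (le_div_iff₀' hbn).mpr hfac
      calc (1 + M) ^ (4 + N) ≤ Real.exp (b * (1 + M)) * (4 + N).factorial / b ^ (4 + N) := this
        _ = _ := by rw [mul_add, mul_one, Real.exp_add]; ring
    calc Real.exp (-(ε' * M)) * (1 + M) ^ (4 + N)
        ≤ Real.exp (-(ε' * M)) *
            ((4 + N).factorial / b ^ (4 + N) * Real.exp b * Real.exp (b * M)) :=
          mul_le_mul_of_nonneg_left h1 (Real.exp_pos _).le
      _ = K * (Real.exp (-(ε' * M)) * Real.exp (b * M)) := by rw [hK]; ring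
      _ = K * Real.exp (-(b * M)) := by rw [← Real.exp_add]; congr 1; rw [hb]; ring
  -- Step 5: exponential decay in both variables
  have hS5a : Real.exp (-(b * M)) ≤ Real.exp (-(c * X)) * Real.exp (-(c * Y)) := by
    rw [← Real.exp_add, Real.exp_le_exp, hb, hc]; nlinarith
  have hS5b : Real.exp (-(b * M)) ≤ Real.exp (-(c * X)) * Real.exp (-(c * D)) := by
    rw [← Real.exp_add, Real.exp_le_exp, hb, hc]; nlinarith
  -- assembly
  have hE0 : 0 ≤ a ^ 8 * Real.exp (-(ε' * M)) := by positivity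
  have hA0 : 0 ≤ a ^ 8 * (K * Real.exp (-(b * M))) := by positivity
  have h0X : 0 ≤ (a + X) ^ (-(max σ 0)) := by positivity
  have h0Y : 0 ≤ (a + Y) ^ (-(max σ 0)) := by positivity
  have h0D : 0 ≤ (a + D) ^ (-(max σ 0)) := by positivity
  calc a ^ 8 * X ^ i * Y ^ j * (Real.exp (-(ε' * M)) * (1 + (a + min X (min Y D)) ^ (-σ)))
      = a ^ 8 * Real.exp (-(ε' * M)) * (X ^ i * Y ^ j * (1 + (a + min X (min Y D)) ^ (-σ))) := by
        ring
    _ ≤ a ^ 8 * Real.exp (-(ε' * M)) *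
          ((1 + M) ^ 4 * ((1 + M) ^ N * (2 + (a + min X (min Y D)) ^ (-(max σ 0))))) :=
        mul_le_mul_of_nonneg_left (mul_le_mul hS1 hS2 (by positivity) (by positivity)) hE0
    _ = a ^ 8 * (Real.exp (-(ε' * M)) * (1 + M) ^ (4 + N)) *
          (2 + (a + min X (min Y D)) ^ (-(max σ 0))) := by rw [pow_add]; ring
    _ ≤ a ^ 8 * (K * Real.exp (-(b * M))) * (2 + (a + min X (min Y D)) ^ (-(max σ 0))) :=
        mul_le_mul_of_nonneg_right (mul_le_mul_of_nonneg_left hS4 (by positivity)) (by positivity)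
    _ ≤ a ^ 8 * (K * Real.exp (-(b * M))) *
          (2 + ((a + X) ^ (-(max σ 0)) + (a + Y) ^ (-(max σ 0)) + (a + D) ^ (-(max σ 0)))) :=
        mul_le_mul_of_nonneg_left (by linarith) hA0
    _ = K * (2 * (a ^ 8 * Real.exp (-(b * M))) +
          (a ^ 8 * Real.exp (-(b * M))) * (a + X) ^ (-(max σ 0))
          + (a ^ 8 * Real.exp (-(b * M))) * (a + Y) ^ (-(max σ 0))
          + (a ^ 8 * Real.exp (-(b * M))) * (a + D) ^ (-(max σ 0))) := by ring
    _ ≤ K * (2 * (a ^ 8 * (Real.exp (-(c * X)) * Real.exp (-(c * Y))))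
          + (a ^ 8 * (Real.exp (-(c * X)) * Real.exp (-(c * Y)))) * (a + X) ^ (-(max σ 0))
          + (a ^ 8 * (Real.exp (-(c * X)) * Real.exp (-(c * Y)))) * (a + Y) ^ (-(max σ 0))
          + (a ^ 8 * (Real.exp (-(c * X)) * Real.exp (-(c * D)))) * (a + D) ^ (-(max σ 0))) := by
        have ha8 : 0 ≤ a ^ 8 := by positivity
        have e1 := mul_le_mul_of_nonneg_left hS5a ha8
        have e2 := mul_le_mul_of_nonneg_left hS5b ha8
        refine mul_le_mul_of_nonneg_left ?_ hK0
        gcongr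
    _ = _ := by ring

end Summit.QuantumFields.QCD.Cruxes.RobustYangMillsHandover.LeeYangMassHandover
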